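import Summits.QuantumFields.YangMills.Theorems.SkewnessNonGeneration.Negative.CompanionFree
import Summits.QuantumFields.YangMills.Theorems.SkewnessNonGeneration.Negative.DilationCovariance

/-!
# K2 slice by slice: idle hypotheses and the calibre of a refutation (negative-side lemmas)

For `BoundedSkewnessRunning.SkewnessNonGeneration` (K2, item `stmt-QuantumFields-19896`), whose
shape is `∀ κ ≥ 1, K2_κ` with `K2_κ` = "gap + RP window on `sch`, a companion `sch'` (same `β, L`,
`a ≤ a'`, window `(a'_k)⁻¹ ≤ β_k^κ`) on which the self-normalised skewness `κ₃^canon` of `tr F²` is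
UV-extinct ⇒ `κ₃^canon → 0` along `sch`":

* `SkewnessNonGenerationAt κ` is the slice `K2_κ`; `K2 ↔ ∀ κ ≥ 1, K2_κ` holds by `Iff.rfl`
  (`skewnessNonGeneration_iff_forall_at`); the slices are ANTITONE in `κ` (a larger exponent admits
  more companions, `skewnessNonGenerationAt_anti`), and MODULO the route's other crux K1
  (`UVSkewnessExtinction`) every single slice `κ ≥ 1` is already equivalent to K2 and to the
  companion-free form `SkewnessNonGenerationCF` (`skewnessNonGenerationAt_iff_CF`,
  `skewnessNonGenerationAt_iff`): the `∀ κ` prefix and the companion are idle modulo K1.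
* the weak-coupling hypothesis is DECORATION on odd slices — it follows from the companion's window,
  `a'_k → 0` and `sch'.β = sch.β` (`hasWeakCouplingLimit_of_window_odd`,
  `hasWeakCouplingLimit_of_companion_odd`) — and carries exactly the SIGN of `β` on even slices
  (`exists_evenWindow_not_hasWeakCouplingLimit`: a scheme inside the `κ = 2` window with `β_k → -∞`),
  and deleting it opens no junk refutation (the zero-coupling model is extinct: companion file
  `ZeroCoupling.lean`).
* calibre (unconditional, no K1): a refutation of K2 exhibits a weakly coupled `SU(2)` Wilson scheme
  with a UNIFORM LATTICE MASS GAP on all large tori and an RP window whose two-point function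
  `T_k(u)` is positive frequently and whose `κ₃^canon` fails to die on one admissible triple
  (`exists_gapped_skewed_of_not_skewnessNonGeneration`,
  `exists_weakCouplingGap_of_not_skewnessNonGeneration`); so K2 holds vacuously if NO weakly coupled
  uniformly gapped `SU(2)` scheme exists.
  An unconditional `¬ K2` therefore contains the lattice half of the Yang–Mills mass gap
  (`HasLatticeMassGap` at `β_k → ∞`), which the tree cannot construct; no junk model refutes K2.
-/

noncomputable section

open scoped SchwartzMap Topology
open MeasureTheory Filter Set
open Literature.MathematicalPhysics.AQFT Literature.MathematicalPhysics.QuantumLattice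
open Literature.MathematicalPhysics.QuantumFieldTheory
open Summit.QuantumFields.YangMills.Theorems.SelfNormalisedSkewness.Negative

namespace Summit.QuantumFields.YangMills.Theorems.SkewnessNonGeneration.Negative

open Summit.QuantumFields.YangMills.Theses.BoundedSkewnessRunning

/-! ## (d) The slices `K2_κ` -/

section Slices

/-- **K2 at a fixed window exponent `κ`** (`K2_κ`): verbatim the body of
`BoundedSkewnessRunning.SkewnessNonGeneration` under its leading `∀ κ : ℕ, 1 ≤ κ →`. -/
def SkewnessNonGenerationAt (κ : ℕ) : Prop :=
  ∀ (r : LatticeRep (Matrix.specialUnitaryGroup (Fin 2) ℂ))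
    (sch sch' : SpeciesScheme (YMSpecies (Matrix.specialUnitaryGroup (Fin 2) ℂ))) (u : 𝓢(E4, ℝ))
    (M Δ : ℝ),
    sch.HasWeakCouplingLimit → 0 < Δ → HasLatticeMassGap r sch Δ →
    HasCompactSupport (u : E4 → ℝ) → tsupport (u : E4 → ℝ) ⊆ {y : E4 | y 0 < 0} →
    (∀ᶠ k in atTop, cruxT r sch u k ≤ M * cruxT r sch (timeShiftTest 4 (-1) u) k) →
    sch'.β = sch.β → sch'.L = sch.L → (∀ k, sch.a k ≤ sch'.a k) →
    (∀ᶠ k in atTop, (sch'.a k)⁻¹ ≤ (sch'.β k) ^ κ) →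
    (∀ (u' f g h : 𝓢(E4, ℝ)), HasCompactSupport (u' : E4 → ℝ) →
      tsupport (u' : E4 → ℝ) ⊆ {y : E4 | y 0 < 0} → HasCompactSupport (f : E4 → ℝ) →
      HasCompactSupport (g : E4 → ℝ) → HasCompactSupport (h : E4 → ℝ) →
      Disjoint (tsupport (f : E4 → ℝ)) (tsupport (g : E4 → ℝ)) →
      Disjoint (tsupport (f : E4 → ℝ)) (tsupport (h : E4 → ℝ)) →
      Disjoint (tsupport (g : E4 → ℝ)) (tsupport (h : E4 → ℝ)) →
      Tendsto (cruxKappa3 r sch' u' f g h) atTop (𝓝 0)) →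
    ∀ (f g h : 𝓢(E4, ℝ)), HasCompactSupport (f : E4 → ℝ) → HasCompactSupport (g : E4 → ℝ) →
      HasCompactSupport (h : E4 → ℝ) → Disjoint (tsupport (f : E4 → ℝ)) (tsupport (g : E4 → ℝ)) →
      Disjoint (tsupport (f : E4 → ℝ)) (tsupport (h : E4 → ℝ)) →
      Disjoint (tsupport (g : E4 → ℝ)) (tsupport (h : E4 → ℝ)) →
      Tendsto (cruxKappa3 r sch u f g h) atTop (𝓝 0)

/-- `K2 ↔ ∀ κ ≥ 1, K2_κ` — definitionally. [folklore] -/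
theorem skewnessNonGeneration_iff_forall_at :
    SkewnessNonGeneration ↔ ∀ κ : ℕ, 1 ≤ κ → SkewnessNonGenerationAt κ :=
  Iff.rfl

/-- **The slices are antitone in `κ`.** Along a weakly coupled scheme `β_k ≥ 1` eventually, so a
companion inside the `κ`-window is inside the `κ'`-window for every `κ' ≥ κ`: the larger exponent
admits MORE companions, hence `K2_{κ'} ⇒ K2_κ`.  (So K2 is the infinite conjunction of ever stronger
slices; no single slice is K2 — except modulo K1, below.) [folklore] -/
theorem skewnessNonGenerationAt_anti {κ κ' : ℕ} (hκκ' : κ ≤ κ')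
    (hK : SkewnessNonGenerationAt κ') : SkewnessNonGenerationAt κ := by
  intro r sch sch' u M Δ hw hΔ hgap huc hup hwin hβ hL ha hUV hext f g h hf hg hh hfg hfh hgh
  refine hK r sch sch' u M Δ hw hΔ hgap huc hup hwin hβ hL ha ?_ hext f g h hf hg hh hfg hfh hgh
  have hβ1 : ∀ᶠ k in atTop, 1 ≤ sch'.β k := by
    rw [hβ]; exact (hw : Tendsto sch.β atTop atTop).eventually_ge_atTop 1
  filter_upwards [hUV, hβ1] with k hk hk1
  exact hk.trans (pow_le_pow_right₀ hk1 hκκ')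

/-- **Modulo K1 every slice already gives the companion-free form.** With K1 at exponent `κ₀`, the
companion `a♯_k = max (a_k, β_k^{-κ}, β_k^{-κ₀})` (same `β, L`) lies inside BOTH the `κ`-window
(so `K2_κ` applies to it) and the `κ₀`-window (so K1 makes it UV-extinct); hence `K2_κ ⇒ CF` for
every `κ ≥ 1`. [folklore] -/
theorem CF_of_skewnessNonGenerationAt (hK1 : UVSkewnessExtinction) {κ : ℕ} (hκ : 1 ≤ κ)
    (hK : SkewnessNonGenerationAt κ) : SkewnessNonGenerationCF := by
  intro r sch u M Δ hw hΔ hgap huc hup hwin f g h hf hg hh hfg hfh hgh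
  obtain ⟨κ₀, hκ₀, hK1⟩ := hK1
  have hβ : Tendsto sch.β atTop atTop := hw
  have hβκ : Tendsto (fun k => ((sch.β k) ^ κ)⁻¹) atTop (𝓝 0) :=
    tendsto_inv_atTop_zero.comp ((tendsto_pow_atTop (by omega)).comp hβ)
  have hβκ₀ : Tendsto (fun k => ((sch.β k) ^ κ₀)⁻¹) atTop (𝓝 0) :=
    tendsto_inv_atTop_zero.comp ((tendsto_pow_atTop (by omega)).comp hβ)
  let sch' : SpeciesScheme (YMSpecies (Matrix.specialUnitaryGroup (Fin 2) ℂ)) :=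
    { sch with
      a := fun k => max (sch.a k) (max ((sch.β k) ^ κ)⁻¹ ((sch.β k) ^ κ₀)⁻¹)
      a_pos := fun k => lt_max_of_lt_left (sch.a_pos k)
      tendsto_a := by
        have h := sch.tendsto_a.max (hβκ.max hβκ₀)
        rw [max_self, max_self] at h
        exact h
      tendsto_L := by
        refine tendsto_atTop_mono (fun k => ?_) sch.tendsto_L
        exact mul_le_mul_of_nonneg_right (le_max_left _ _) (Nat.cast_nonneg _) }
  have hβpos : ∀ᶠ k in atTop, 0 < sch.β k := hβ.eventually_gt_atTop 0
  have hUVκ : ∀ᶠ k in atTop, (sch'.a k)⁻¹ ≤ (sch'.β k) ^ κ := by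
    filter_upwards [hβpos] with k hk
    have hp : 0 < ((sch.β k) ^ κ)⁻¹ := inv_pos.2 (pow_pos hk κ)
    have h1 : ((sch.β k) ^ κ)⁻¹ ≤ max (sch.a k) (max ((sch.β k) ^ κ)⁻¹ ((sch.β k) ^ κ₀)⁻¹) :=
      (le_max_left _ _).trans (le_max_right _ _)
    have h2 := inv_anti₀ hp h1
    rwa [inv_inv] at h2
  have hUVκ₀ : ∀ᶠ k in atTop, (sch'.a k)⁻¹ ≤ (sch'.β k) ^ κ₀ := by
    filter_upwards [hβpos] with k hk
    have hp : 0 < ((sch.β k) ^ κ₀)⁻¹ := inv_pos.2 (pow_pos hk κ₀)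
    have h1 : ((sch.β k) ^ κ₀)⁻¹ ≤ max (sch.a k) (max ((sch.β k) ^ κ)⁻¹ ((sch.β k) ^ κ₀)⁻¹) :=
      (le_max_right _ _).trans (le_max_right _ _)
    have h2 := inv_anti₀ hp h1
    rwa [inv_inv] at h2
  have hw' : sch'.HasWeakCouplingLimit := hw
  have hext' : ∀ (u' f g h : 𝓢(E4, ℝ)), HasCompactSupport (u' : E4 → ℝ) →
      tsupport (u' : E4 → ℝ) ⊆ {y : E4 | y 0 < 0} → HasCompactSupport (f : E4 → ℝ) →
      HasCompactSupport (g : E4 → ℝ) → HasCompactSupport (h : E4 → ℝ) →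
      Disjoint (tsupport (f : E4 → ℝ)) (tsupport (g : E4 → ℝ)) →
      Disjoint (tsupport (f : E4 → ℝ)) (tsupport (h : E4 → ℝ)) →
      Disjoint (tsupport (g : E4 → ℝ)) (tsupport (h : E4 → ℝ)) →
      Tendsto (cruxKappa3 r sch' u' f g h) atTop (𝓝 0) :=
    fun u' f g h hu'c hu'n hf hg hh hfg hfh hgh =>
      hK1 r sch' u' hw' hUVκ₀ hu'c hu'n f g h hf hg hh hfg hfh hgh
  exact hK r sch sch' u M Δ hw hΔ hgap huc hup hwin rfl rfl (fun k => le_max_left _ _) hUVκ hext'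
    f g h hf hg hh hfg hfh hgh

/-- Modulo K1: `K2_κ ↔ CF` for every `κ ≥ 1`. [folklore] -/
theorem skewnessNonGenerationAt_iff_CF (hK1 : UVSkewnessExtinction) {κ : ℕ} (hκ : 1 ≤ κ) :
    SkewnessNonGenerationAt κ ↔ SkewnessNonGenerationCF :=
  ⟨CF_of_skewnessNonGenerationAt hK1 hκ, fun hCF => (skewnessNonGeneration_of_CF hCF) κ hκ⟩

/-- **Modulo K1 the `∀ κ` prefix is idle**: every single slice `K2_κ` (`κ ≥ 1`) — in particular the
WEAKEST one, `K2_1` — is equivalent to K2. [folklore] -/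
theorem skewnessNonGenerationAt_iff (hK1 : UVSkewnessExtinction) {κ : ℕ} (hκ : 1 ≤ κ) :
    SkewnessNonGenerationAt κ ↔ SkewnessNonGeneration :=
  ⟨fun h => skewnessNonGeneration_of_CF (CF_of_skewnessNonGenerationAt hK1 hκ h),
    fun h => h κ hκ⟩

end Slices

/-! ## (e) Load-bearing analysis: the weak-coupling hypothesis -/

section WeakCoupling

/-- **On odd slices `hw` is decoration.** A scheme inside the `κ`-window, `(a_k)⁻¹ ≤ β_k^κ`
eventually, has `β_k^κ → +∞` (because `a_k → 0⁺`), hence `β_k → +∞` when `κ` is odd. [folklore] -/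
theorem hasWeakCouplingLimit_of_window_odd {ι : Type} {κ : ℕ} (hκ : Odd κ) (sch : SpeciesScheme ι)
    (hUV : ∀ᶠ k in atTop, (sch.a k)⁻¹ ≤ (sch.β k) ^ κ) : sch.HasWeakCouplingLimit := by
  have h0 : Tendsto sch.a atTop (𝓝[>] 0) :=
    tendsto_nhdsWithin_iff.2 ⟨sch.tendsto_a, Eventually.of_forall fun k => sch.a_pos k⟩
  have ha : Tendsto (fun k => (sch.a k)⁻¹) atTop atTop := h0.inv_tendsto_nhdsGT_zero
  have hpow : Tendsto (fun k => (sch.β k) ^ κ) atTop atTop := tendsto_atTop_mono' atTop hUV ha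
  have hmono : StrictMono fun x : ℝ => x ^ κ := hκ.strictMono_pow
  show Tendsto sch.β atTop atTop
  refine tendsto_atTop.2 fun b => ?_
  filter_upwards [hpow.eventually_ge_atTop (b ^ κ)] with k hk
  exact hmono.le_iff_le.1 hk

/-- The K2 form: with `sch'.β = sch.β`, an odd-`κ` companion window gives `hw` for `sch`; the
hypothesis `sch.HasWeakCouplingLimit` of `K2_κ` is implied by the others for odd `κ`. [folklore] -/
theorem hasWeakCouplingLimit_of_companion_odd {ι : Type} {κ : ℕ} (hκ : Odd κ)
    {sch sch' : SpeciesScheme ι} (hβ : sch'.β = sch.β)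
    (hUV : ∀ᶠ k in atTop, (sch'.a k)⁻¹ ≤ (sch'.β k) ^ κ) : sch.HasWeakCouplingLimit := by
  have h := hasWeakCouplingLimit_of_window_odd hκ sch' hUV
  unfold SpeciesScheme.HasWeakCouplingLimit at h ⊢
  rwa [hβ] at h

/-- **On even slices `hw` carries exactly the sign of `β`.** The scheme `a_k = (k+1)⁻²`,
`β_k = -(k+1)`, `L_k = (k+1)³` sits inside the `κ = 2` window and has `β_k → -∞`: there the
window does NOT give weak coupling (negative-`β` Wilson theory is the frustrated `U_p ≈ -1` regime,
excluded from K2 by `hw` alone). [folklore] -/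
theorem exists_evenWindow_not_hasWeakCouplingLimit (ι : Type) :
    ∃ sch : SpeciesScheme ι,
      (∀ᶠ k in atTop, (sch.a k)⁻¹ ≤ (sch.β k) ^ 2) ∧ ¬ sch.HasWeakCouplingLimit := by
  have h1 : Tendsto (fun k : ℕ => (k : ℝ) + 1) atTop atTop :=
    tendsto_atTop_add_const_right _ _ tendsto_natCast_atTop_atTop
  refine ⟨{ a := fun k => (((k : ℝ) + 1) ^ 2)⁻¹
            a_pos := fun k => by positivity
            tendsto_a := tendsto_inv_atTop_zero.comp ((tendsto_pow_atTop two_ne_zero).comp h1)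
            β := fun k => -((k : ℝ) + 1)
            L := fun k => (k + 1) ^ 3
            tendsto_L := ?_
            c := fun _ _ => 0
            m := fun _ _ => 0 }, ?_, ?_⟩
  · have e : (fun k : ℕ => (((k : ℝ) + 1) ^ 2)⁻¹ * (((k + 1) ^ 3 : ℕ) : ℝ)) =
        fun k : ℕ => (k : ℝ) + 1 := by
      funext k
      have hk : (k : ℝ) + 1 ≠ 0 := by positivity
      push_cast
      field_simp
    show Tendsto (fun k : ℕ => (((k : ℝ) + 1) ^ 2)⁻¹ * (((k + 1) ^ 3 : ℕ) : ℝ)) atTop atTop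
    rw [e]; exact h1
  · exact Eventually.of_forall fun k => by simp only [inv_inv, neg_sq, le_refl]
  · intro hw
    obtain ⟨k, hk⟩ := ((hw : Tendsto _ atTop atTop).eventually_ge_atTop 0).exists
    have : (0 : ℝ) < (k : ℝ) + 1 := by positivity
    change (0 : ℝ) ≤ -((k : ℝ) + 1) at hk
    linarith

end WeakCoupling


/-! ## (f) Calibre of a refutation (unconditional) -/

section Calibre

/-- **What `¬ K2` must exhibit** (no K1 used): a faithful unitary representation of `SU(2)`, a
weakly coupled Wilson scheme with a UNIFORM LATTICE MASS GAP `Δ > 0` on all tori `S ≥ L_k`, an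
admissible `u` with an RP window whose two-point function `T_k(u)` is positive for infinitely many
`k` (else the self-normalisation collapses and the conclusion holds trivially,
`tendsto_cruxKappa3_of_eventually_cruxT_nonpos`), and one compactly supported triple on which
`κ₃^canon` does not die. [folklore] -/
theorem exists_gapped_skewed_of_not_skewnessNonGeneration (hK : ¬ SkewnessNonGeneration) :
    ∃ (r : LatticeRep (Matrix.specialUnitaryGroup (Fin 2) ℂ))
      (sch : SpeciesScheme (YMSpecies (Matrix.specialUnitaryGroup (Fin 2) ℂ))) (u : 𝓢(E4, ℝ))
      (M Δ : ℝ) (f g h : 𝓢(E4, ℝ)),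
      sch.HasWeakCouplingLimit ∧ 0 < Δ ∧ HasLatticeMassGap r sch Δ ∧
      HasCompactSupport (u : E4 → ℝ) ∧ tsupport (u : E4 → ℝ) ⊆ {y : E4 | y 0 < 0} ∧
      (∀ᶠ k in atTop, cruxT r sch u k ≤ M * cruxT r sch (timeShiftTest 4 (-1) u) k) ∧
      (∃ᶠ k in atTop, 0 < cruxT r sch u k) ∧
      ¬ Tendsto (cruxKappa3 r sch u f g h) atTop (𝓝 0) := by
  unfold SkewnessNonGeneration at hK
  push Not at hK
  obtain ⟨κ, -, r, sch, sch', u, M, Δ, hw, hΔ, hgap, huc, hup, hwin, -, -, -, -, -, f, g, h, -, -,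
    -, -, -, -, hnot⟩ := hK
  refine ⟨r, sch, u, M, Δ, f, g, h, hw, hΔ, hgap, huc, hup, hwin, ?_, hnot⟩
  by_contra hfr
  rw [not_frequently] at hfr
  exact hnot (tendsto_cruxKappa3_of_eventually_cruxT_nonpos r sch u f g h
    (hfr.mono fun k hk => not_lt.1 hk))

/-- **No weakly coupled lattice gap, no refutation.** Contrapositive reading of the calibre: `¬ K2`
already yields a faithful `SU(2)` Wilson scheme with `β_k → ∞` and a uniform lattice mass gap — the
lattice half of the Yang–Mills mass gap, which the tree cannot construct and no degenerate model
supplies (at `β ≡ 0` the gap holds but `hw` fails; every junk model makes the conclusion of K2 true).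
Equivalently, K2 holds vacuously if no such scheme exists. [folklore] -/
theorem exists_weakCouplingGap_of_not_skewnessNonGeneration (hK : ¬ SkewnessNonGeneration) :
    ∃ (r : LatticeRep (Matrix.specialUnitaryGroup (Fin 2) ℂ))
      (sch : SpeciesScheme (YMSpecies (Matrix.specialUnitaryGroup (Fin 2) ℂ))) (Δ : ℝ),
      sch.HasWeakCouplingLimit ∧ 0 < Δ ∧ HasLatticeMassGap r sch Δ := by
  obtain ⟨r, sch, -, -, Δ, -, -, -, hw, hΔ, hgap, -⟩ :=
    exists_gapped_skewed_of_not_skewnessNonGeneration hK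
  exact ⟨r, sch, Δ, hw, hΔ, hgap⟩

end Calibre

end Summit.QuantumFields.YangMills.Theorems.SkewnessNonGeneration.Negative

end
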